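import Mathlib
import Literature.Probability.LatticeModels.GKSInequalities
import HarnessLib

/-!
# Crux `PrecisionLaplacian.InverseMFerromagnet` (stmt-CriticalPhenomena-4798), line `Sketch` — level ≤ 1 of the
# partial-covariance ladder (helper, lead prover-line-stmt-CriticalPhenomena-4798-0)

THEOREM-ONLY helper file (no definitions).  In the line's Schur form, IM is `PCov(x,y | lin σ_S) ≥ 0` for
`S = univ ∖ {x,y}`, where `PCov(x,y|S) = Σ_xy − Σ_{xS}(Σ_SS)⁻¹Σ_{Sy}` and `Σ_pq = ⟨σ_pσ_q⟩`
(`gksExpect univ K C`).  This file proves the two lowest levels, used verbatim by the skeleton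
`Cruxes/InverseMFerromagnet/Lines/Sketch.lean` (`InverseMFerromagnet_of`, case `|S| ≤ 1`):
`S = ∅` is GKS I (`⟨σ_xσ_y⟩ ≥ 0`), `S = {a}` is GKS II (`⟨σ_xσ_y⟩ ≥ ⟨σ_xσ_a⟩⟨σ_aσ_y⟩`, `⟨σ_aσ_a⟩ = 1`).
-/

namespace Summit.CriticalPhenomena.Ising3DConformalLimit.Cruxes.InverseMFerromagnet.PartialCovarianceLadder

open Literature.Probability.LatticeModels Finset Matrix
open scoped symmDiff

noncomputable section

/-! ## Level ≤ 1 (GKS I / II), proved -/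

/-- `⟨σ_xσ_y⟩ = ⟨σ_{{x,y}}⟩` for `x ≠ y`. [folklore] -/
theorem gksExpect_pair_eq_spinProduct (n m : ℕ) (K : Fin m → ℝ) (C : Fin m → Finset (Fin n))
    {x y : Fin n} (hxy : x ≠ y) :
    gksExpect Finset.univ K C (fun ω => spinAt x ω * spinAt y ω)
      = gksExpect Finset.univ K C (spinProduct {x, y}) := by
  congr 1
  funext ω
  simp [spinProduct, Finset.prod_pair hxy]

/-- `⟨σ_xσ_x⟩ = 1`. [folklore] -/
theorem gksExpect_pair_self (n m : ℕ) (K : Fin m → ℝ) (C : Fin m → Finset (Fin n)) (x : Fin n) :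
    gksExpect Finset.univ K C (fun ω => spinAt x ω * spinAt x ω) = 1 := by
  simp [gksExpect, (gksSum_one_pos _ _ _).ne']

/-- `{x,a} ∆ {a,y} = {x,y}` for pairwise distinct `x, a, y`. [folklore] -/
theorem pair_symmDiff_pair {n : ℕ} {x a y : Fin n} (hxy : x ≠ y) (hxa : x ≠ a) (hya : y ≠ a) :
    (({x, a} : Finset (Fin n)) ∆ {a, y}) = {x, y} := by
  ext z
  simp only [Finset.mem_symmDiff, Finset.mem_insert, Finset.mem_singleton]
  constructor
  · rintro (⟨h1 | h1, h2⟩ | ⟨h1 | h1, h2⟩) <;> simp_all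
  · rintro (rfl | rfl)
    · left; exact ⟨Or.inl rfl, fun h => h.elim (fun h => hxa h) (fun h => hxy h)⟩
    · right; exact ⟨Or.inr rfl, fun h => h.elim (fun h => hxy h.symm) (fun h => hya h)⟩

/-- Level `0` and level `1`: for `S = ∅` the partial covariance is `⟨σ_xσ_y⟩ ≥ 0` (GKS I); for
`S = {a}` it is `⟨σ_xσ_y⟩ − ⟨σ_xσ_a⟩⟨σ_aσ_y⟩ ≥ 0` (GKS II, `⟨σ_aσ_a⟩ = 1`). [folklore] -/
theorem pcov_nonneg_of_card_le_one
    (n m : ℕ) (K : Fin m → ℝ) (C : Fin m → Finset (Fin n)) (hK : ∀ i, 0 ≤ K i) (_hC : ∀ i, (C i).card = 2)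
    (G : Matrix (Fin n) (Fin n) ℝ)
    (hG : G = Matrix.of (fun p q : Fin n => gksExpect Finset.univ K C (fun ω => spinAt p ω * spinAt q ω)))
    (x y : Fin n) (S : Finset (Fin n)) (hxy : x ≠ y) (hx : x ∉ S) (hy : y ∉ S) (hS : S.card ≤ 1) :
    0 ≤ G x y - ∑ p : ↥S, ∑ q : ↥S,
        G x p.1 * (G.submatrix (Subtype.val : ↥S → Fin n) (Subtype.val : ↥S → Fin n))⁻¹ p q * G q.1 y := by
  subst hG
  rcases Nat.le_one_iff_eq_zero_or_eq_one.1 hS with h0 | h1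
  · have hS0 : S = ∅ := Finset.card_eq_zero.1 h0
    subst hS0
    simp only [Finset.univ_eq_empty, Finset.sum_empty, sub_zero, Matrix.of_apply]
    rw [gksExpect_pair_eq_spinProduct n m K C hxy]
    exact gksExpect_spinProduct_nonneg _ _ _ (fun i _ => hK i) _
  · obtain ⟨a, rfl⟩ := Finset.card_eq_one.1 h1
    have hxa : x ≠ a := by simpa using hx
    have hya : y ≠ a := by simpa using hy
    -- the `1×1` block `Σ_{aa} = 1` is the identity matrix
    have hM : (Matrix.of (fun p q : Fin n =>
          gksExpect Finset.univ K C (fun ω => spinAt p ω * spinAt q ω))).submatrix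
        (Subtype.val : ↥({a} : Finset (Fin n)) → Fin n) (Subtype.val : ↥({a} : Finset (Fin n)) → Fin n)
        = 1 := by
      ext p q
      have hp : p.1 = a := Finset.mem_singleton.1 p.2
      have hq : q.1 = a := Finset.mem_singleton.1 q.2
      have hpq : p = q := Subtype.ext (hp.trans hq.symm)
      subst hpq
      simp [Matrix.submatrix_apply, gksExpect, (gksSum_one_pos _ _ _).ne']
    rw [hM, inv_one]
    have huniv : (Finset.univ : Finset ↥({a} : Finset (Fin n)))
        = {⟨a, Finset.mem_singleton_self a⟩} := by
      ext p
      simp only [Finset.mem_univ, Finset.mem_singleton, true_iff]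
      exact Subtype.ext (Finset.mem_singleton.1 p.2)
    rw [huniv, Finset.sum_singleton, Finset.sum_singleton]
    simp only [Matrix.one_apply_eq, mul_one, Matrix.of_apply]
    rw [gksExpect_pair_eq_spinProduct n m K C hxy, gksExpect_pair_eq_spinProduct n m K C hxa,
      gksExpect_pair_eq_spinProduct n m K C (Ne.symm hya)]
    have h := gksExpect_mul_gksExpect_le Finset.univ K C (fun i _ => hK i) {x, a} {a, y}
    rw [pair_symmDiff_pair hxy hxa hya] at h
    linarith


/-- Registered helper `helper_level_le_one` (levels `0, 1` of the partial-covariance ladder, in the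
registered `∀`-form): `PCov(x,y|S) ≥ 0` for `|S| ≤ 1`, by GKS I / GKS II. [folklore] -/
theorem helper_level_le_one :
    ∀ (n m : ℕ) (K : Fin m → ℝ) (C : Fin m → Finset (Fin n)), (∀ i, 0 ≤ K i) → (∀ i, (C i).card = 2) → ∀ G : Matrix (Fin n) (Fin n) ℝ, G = Matrix.of (fun p q : Fin n => gksExpect Finset.univ K C (fun ω => spinAt p ω * spinAt q ω)) → ∀ (x y : Fin n) (S : Finset (Fin n)), x ≠ y → x ∉ S → y ∉ S → S.card ≤ 1 → 0 ≤ G x y - ∑ p : ↥S, ∑ q : ↥S, G x p.1 * (G.submatrix (Subtype.val : ↥S → Fin n) (Subtype.val : ↥S → Fin n))⁻¹ p q * G q.1 y :=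
  fun n m K C hK hC G hG x y S hxy hx hy hS =>
    pcov_nonneg_of_card_le_one n m K C hK hC G hG x y S hxy hx hy hS

end

end Summit.CriticalPhenomena.Ising3DConformalLimit.Cruxes.InverseMFerromagnet.PartialCovarianceLadder
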